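import Summits.AtomisticToContinuum.FouriersLaw.Theorems.PhononMeanFreePathDefs
import Summits.AtomisticToContinuum.FouriersLaw.Theorems.IncoherentChannel.Negative.GibbsStein
import Summits.AtomisticToContinuum.FouriersLaw.Theorems.BondHeatUncertaintySubdiffusiveBondHeatKernelGibbsD

/-!
# `0 < γ` is load-bearing for the ENGINE of line `two-horizons-forecast-loss` (negative-side support)

Support lemmas for crux `PhononMeanFreePath.IncoherentChannel` (item stmt-AtomisticToContinuum-11811)
from the standing disprover's work file `Cruxes/IncoherentChannel/Disproof.lean` §6 (gen 3), about the
lead's open stub `stub_forecastLoss` (the `N`-uniform forecast-loss envelope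
`S_N(t) = fnorm … N t = ‖K_t p_N‖²_{L²(μ_T)} ≤ C(1+t)^{-α}`, `α > 2`), all sorry-free, no new definitions:

* `transitionKernel_gamma_zero`: WITHOUT BATHS (`γ = 0`) the constructed transition kernel of
  `pinnedChain ω₂ lam β 0` is the Dirac mass at the deterministic Hamiltonian flow (the momentum noise
  `chainNoise` has amplitude `√(2·0·T) = 0`), so the mean forecast is exact, `v_t = p_N ∘ Φ_t`
  (`fcast_gamma_zero`);
* `fnorm_gamma_zero`: hence `S_N(t) = ∫ (p_N ∘ Φ_t)² dμ_T = ∫ p_N² dμ_T = T` for EVERY `N` and `t`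
  (Gibbs invariance of the kernels, in the tree for `γ ≥ 0`, plus equipartition);
* `forecastLoss_false_without_gammaPos`: the engine with `0 ≤ γ` admitted is FALSE — a constant `T > 0`
  is not dominated by `C(1+t)^{-α} → 0`. So `0 < γ` enters the line at the engine itself (loss of
  predictability is produced by the baths only), not merely through the prefactor `γ²/T²` of the crux
  (`LoadBearing.crux_false_without_gammaPos`).
-/

noncomputable section

open MeasureTheory Filter Topology Set
open scoped NNReal
open Literature.MathematicalPhysics.KineticTheory.HeatConduction
open Literature.Probability.Process
open Summit.AtomisticToContinuum.FouriersLaw.Theorems.PhononMeanFreePath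
open Summit.AtomisticToContinuum.FouriersLaw.Theorems.SubdiffusiveBondHeat
  (pinnedChain_integral_transitionKernel_gibbsMeasure)
open Summit.AtomisticToContinuum.FouriersLaw.Theorems.IncoherentChannel.Negative.GibbsStein
  (gibbs_sq_momentum integrable_gibbsMeasure_of_growth)

namespace Summit.AtomisticToContinuum.FouriersLaw.Theorems.IncoherentChannel.Negative.ForecastLossGammaZero

section GammaZero

variable {ω₂ lam β : ℝ} (hω : 0 < ω₂) (hl : 0 ≤ lam) (hβ : 0 ≤ β) (N : ℕ)

/-- Without baths the momentum noise vanishes identically (amplitudes `√(2·0·T) = 0`). [folklore] -/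
theorem chainNoise_gamma_zero (T_L T_R : ℝ) (w : WienerPair) :
    chainNoise N (Real.sqrt (2 * (pinnedChain ω₂ lam β 0).γ * T_L))
      (Real.sqrt (2 * (pinnedChain ω₂ lam β 0).γ * T_R)) w = 0 := by
  funext s i
  simp [chainNoise]

/-- Without baths the solution map is the deterministic flow (no dependence on the driving paths).
[folklore] -/
theorem solMap_gamma_zero (T_L T_R t : ℝ) (x : PhaseSpace N) (w : WienerPair) :
    (pinnedChain ω₂ lam β 0).solMap N T_L T_R t x w = (pinnedChain ω₂ lam β 0).chainFlow N x 0 t := by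
  unfold OscillatorChain.solMap
  rw [chainNoise_gamma_zero N T_L T_R w]

include hω hl hβ in
/-- **At `γ = 0` the transition kernel is the Dirac mass at the deterministic flow.** [folklore] -/
theorem transitionKernel_gamma_zero (T_L T_R : ℝ) (t : ℝ≥0) (x : PhaseSpace N) :
    (pinnedChain ω₂ lam β 0).transitionKernel N T_L T_R t x =
      Measure.dirac ((pinnedChain ω₂ lam β 0).chainFlow N x 0 t) := by
  rw [pinnedChain_transitionKernel_apply hω hl hβ le_rfl]
  have h : (fun ω : WienerPair => (pinnedChain ω₂ lam β 0).solMap N T_L T_R (t : ℝ) x (pairPath ω)) =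
      fun _ => (pinnedChain ω₂ lam β 0).chainFlow N x 0 t :=
    funext fun ω => solMap_gamma_zero N T_L T_R t x _
  rw [h, Measure.map_const, measure_univ, one_smul]

include hω hl hβ in
/-- `P_t g(x) = g(Φ_t x)` at `γ = 0`. [folklore] -/
theorem integral_transitionKernel_gamma_zero (T_L T_R : ℝ) (t : ℝ≥0) (x : PhaseSpace N)
    (g : PhaseSpace N → ℝ) :
    ∫ y, g y ∂((pinnedChain ω₂ lam β 0).transitionKernel N T_L T_R t x) =
      g ((pinnedChain ω₂ lam β 0).chainFlow N x 0 t) := by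
  rw [transitionKernel_gamma_zero hω hl hβ N, integral_dirac]

include hω hl hβ in
/-- At `γ = 0` the forecast is exact: `v_t = p_N ∘ Φ_t`. [folklore] -/
theorem fcast_gamma_zero (T t : ℝ) (z : PhaseSpace (N + 1)) :
    fcast ω₂ lam β 0 T N t z =
      ((pinnedChain ω₂ lam β 0).chainFlow (N + 1) z 0 (t.toNNReal : ℝ)).2 (Fin.last N) := by
  unfold fcast
  rw [integral_transitionKernel_gamma_zero hω hl hβ (N + 1)]

include hω hl hβ in
/-- **`S_N(t) = T` for every `N`, `t` at `γ = 0`**: the forecast norm of the isolated chain is the full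
equilibrium variance of `p_N` (Gibbs invariance of the deterministic flow — the `γ ≥ 0` case of the
kernel invariance in the tree — plus equipartition). [folklore] -/
theorem fnorm_gamma_zero {T : ℝ} (hT : 0 < T) (t : ℝ) : fnorm ω₂ lam β 0 T N t = T := by
  unfold fnorm
  have h1 : ∀ z : PhaseSpace (N + 1), fcast ω₂ lam β 0 T N t z ^ 2 =
      ∫ y, y.2 (Fin.last N) ^ 2 ∂((pinnedChain ω₂ lam β 0).transitionKernel (N + 1) T T t.toNNReal z) := by
    intro z
    rw [fcast_gamma_zero hω hl hβ N, integral_transitionKernel_gamma_zero hω hl hβ (N + 1)]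
  simp_rw [h1]
  have hI : Integrable (fun y : PhaseSpace (N + 1) => y.2 (Fin.last N) ^ 2)
      ((pinnedChain ω₂ lam β 0).gibbsMeasure (N + 1) T) := by
    refine integrable_gibbsMeasure_of_growth hω hl hβ hT (by fun_prop) (A := 1) fun x => ?_
    have h1 := OscillatorChain.abs_snd_apply_le_norm x (Fin.last N)
    rw [abs_pow]
    calc |x.2 (Fin.last N)| ^ 2 ≤ ‖x‖ ^ 2 := pow_le_pow_left₀ (abs_nonneg _) h1 2
      _ ≤ 1 * (1 + ‖x‖ ^ 2) ^ 2 := by nlinarith [norm_nonneg x]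
  rw [pinnedChain_integral_transitionKernel_gibbsMeasure hω hl hβ le_rfl (Nat.succ_pos N) hT _ hI]
  exact gibbs_sq_momentum hω hl hβ hT (Fin.last N)

end GammaZero

/-- A decaying envelope cannot dominate a positive constant. [folklore] -/
theorem not_const_le_envelope {S C α : ℝ} (hS : 0 < S) (hα : 0 < α)
    (h : ∀ t : ℝ, 0 ≤ t → S ≤ C * (1 + t) ^ (-α)) : False := by
  have hlim : Tendsto (fun t : ℝ => C * (1 + t) ^ (-α)) atTop (𝓝 0) := by
    have h1 : Tendsto (fun t : ℝ => (1 + t) ^ (-α)) atTop (𝓝 0) :=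
      (tendsto_rpow_neg_atTop hα).comp (tendsto_atTop_add_const_left atTop 1 tendsto_id)
    simpa using h1.const_mul C
  have hev : ∀ᶠ t : ℝ in atTop, C * (1 + t) ^ (-α) < S := hlim.eventually (gt_mem_nhds hS)
  obtain ⟨t, ht, ht0⟩ := (hev.and (eventually_ge_atTop 0)).exists
  exact absurd (h t ht0) (not_le.2 ht)

/-- **The forecast-loss envelope is FALSE for the isolated chain** (`γ = 0`; any `ω₂ > 0`,
`lam, β ≥ 0`, `T > 0`): `S_N(t) ≡ T` does not decay. [folklore] -/
theorem forecastLoss_false_at_gamma_zero {ω₂ lam β T : ℝ} (hω : 0 < ω₂) (hl : 0 ≤ lam) (hβ : 0 ≤ β)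
    (hT : 0 < T) :
    ¬ ∃ C α : ℝ, 2 < α ∧ ∀ (N : ℕ) (t : ℝ), 0 ≤ t → fnorm ω₂ lam β 0 T N t ≤ C * (1 + t) ^ (-α) := by
  rintro ⟨C, α, hα, h⟩
  refine not_const_le_envelope hT (by linarith : 0 < α) (C := C) fun t ht => ?_
  have := h 0 t ht
  rwa [fnorm_gamma_zero hω hl hβ 0 hT t] at this

/-- **`0 < γ` is load-bearing for the ENGINE**: the lead's stub `stub_forecastLoss` of line
`two-horizons-forecast-loss` with `0 ≤ γ` admitted (in place of `0 < γ`) is FALSE. [folklore] -/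
theorem forecastLoss_false_without_gammaPos :
    ¬ ∀ ω₂ lam β γ : ℝ, 0 < ω₂ → 0 < lam → 0 < β → 0 ≤ γ → ∀ T : ℝ, 0 < T →
      ∃ C α : ℝ, 2 < α ∧ ∀ (N : ℕ) (t : ℝ), 0 ≤ t → fnorm ω₂ lam β γ T N t ≤ C * (1 + t) ^ (-α) :=
  fun h => forecastLoss_false_at_gamma_zero one_pos zero_le_one zero_le_one one_pos
    (h 1 1 1 0 one_pos one_pos one_pos le_rfl 1 one_pos)

end Summit.AtomisticToContinuum.FouriersLaw.Theorems.IncoherentChannel.Negative.ForecastLossGammaZero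

end
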